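import Literature.AlgebraicGeometry.Frobenioids.ArchimedeanAngularLength
import Literature.AlgebraicGeometry.Frobenioids.ArchimedeanIsotropyPropagation
import Literature.AlgebraicGeometry.Frobenioids.ArchimedeanCoAngular
import HarnessLib

/-!
# Frobenioids II, Proposition 3.4 (viii): the FSMI-potential of an object of `C₀`
# ("angular regions never shrink", quantified along the arrows of `C₀`)

Mochizuki, *The geometry of Frobenioids II: poly-Frobenioids*, Kyushu J. Math. **62** (2008)
401–460, §3, proof of Proposition 3.4 (viii), p. 32 ll. 15–30 [cite: MochizukiFrdII2008, Prop 3.4 (viii) p.32]: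
"by Lemma 3.2, (iv) [which may be interpreted as asserting that 'angular regions never shrink'], (v),
there exists an integer `N` such that given any composite `φ_n ∘ ⋯ ∘ φ_1` of [not necessarily FSMI-!]
morphisms `φ_1, …, φ_n` such that the domain of `φ_1` is equal to `A`, it holds that the cardinality of
the set of `j` … such that `φ_j` is an FSMI-morphism [which implies that `φ_j` is a monomorphism which is
a base-isomorphism between complex objects — cf. Remark 3.3.1] and non-linear is `≤ N`. In this
situation, any linear FSMI-morphism `φ_j` … is necessarily a slit morphism … — which implies that the
codomain of `φ_j` is isotropic, so no `φ_{j′}`, where `j′ > j`, can be a slit morphism".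

This file (abc-iut cell, layer L1, sub-DAG `SUBDAG-FrdII-Prop34.md` rows P34-L10/L11, seat abc-iut-w5-d092)
packages the printed counting argument as an integer POTENTIAL on the objects of `C₀` (Ex. 3.3 (i)):
`lenRank B := ⌊log₂ ⌊2π / dirLen B⌋⌋` for an angular part `B`, and
`C0.fsmiRank X := 0` for real `X`, `lenRank B_X + [X not isotropic]` for complex `X`. PROVED:

* `C0.dirLen_le_of_hom` — along ANY arrow `X → Y` of `C₀` the angular length does not decrease (condition
  (c) of Ex. 3.3 (i): a translate of `B_X` lies in `B_X^{·d}`, which maps into a Galois twist of `B_Y`);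
  hence `C0.fsmiRank_le_of_hom`: the potential never increases.
* `C0.fsmiRank_lt_of_injOn` — along an arrow of Frobenius degree `d ≥ 2` between complex objects that is
  INJECTIVE on the angular region (= a monomorphism, Remark 3.3.1) the potential drops: injectivity of
  `z ↦ z^d` on `B_X` forces `d · dirLen B_X ≤ 2π` (Lemma 3.2 (v)) and then `dirLen B_Y ≥ d · dirLen B_X`
  (Lemma 3.2 (iv): "`φ_d` multiplies lengths by `d`").
* `C0.fsmiRank_lt_of_isIsotropic` — from a non-isotropic complex object to an isotropic (or real) one the
  potential drops (the slit case).

Consumers (`ArchimedeanFSMIChains*.lean`): the number of FSMI-morphisms in any chain of the angular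
Frobenioid `A₀` / the angloids `N₀`, `R₀` out of an object `A` is `≤ C0.fsmiRank A + 1` — condition (b) of
"FSMFF-type" for `F₀` in the proof of Prop. 3.4 (viii). [FrdII] §3 is classical and undisputed; nothing
here restates a numbered statement of the paper.
-/

namespace Literature.AlgebraicGeometry.Frobenioids

open Set Function Topology Real CategoryTheory
open scoped Pointwise

noncomputable section

namespace ArchFrd

/-! ### The integer potential of an angular part -/

section Rank

/-- **The integer behind the `N` of Prop. 3.4 (viii)** (p. 32 l. 20): `⌊log₂ ⌊2π / dirLen B⌋⌋`, the
number of times the angular length of `B` can still be doubled inside `S¹`.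
[cite: MochizukiFrdII2008, Prop 3.4 (viii) p.32] -/
def lenRank (B : Set ↥(normOneSubgroup ℂ)) : ℕ := Nat.log 2 ⌊2 * π / dirLen B⌋₊

variable {B B' : Set ↥(normOneSubgroup ℂ)}

/-- The potential does not increase when the length does not decrease.
[cite: MochizukiFrdII2008, Prop 3.4 (viii) p.32] -/
theorem lenRank_anti (h : dirLen B ≤ dirLen B') : lenRank B' ≤ lenRank B := by
  unfold lenRank
  refine Nat.log_mono_right (Nat.floor_le_floor ?_)
  exact div_le_div_of_nonneg_left (by positivity) (dirLen_pos B) h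

/-- The potential DROPS when the length at least doubles. [cite: MochizukiFrdII2008, Prop 3.4 (viii) p.32] -/
theorem lenRank_lt_of_two_mul_le (h : 2 * dirLen B ≤ dirLen B') : lenRank B' < lenRank B := by
  unfold lenRank
  have hB := dirLen_pos B
  have hB' := dirLen_pos B'
  have h2π := dirLen_le_two_pi B'
  -- `k := ⌊2π / dirLen B'⌋ ≥ 1` and `⌊2π / dirLen B⌋ ≥ 2k`
  set k := ⌊2 * π / dirLen B'⌋₊ with hk
  have hk1 : 1 ≤ k := by
    rw [hk, Nat.one_le_floor_iff, one_le_div hB']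
    exact h2π
  have h2k : k * 2 ≤ ⌊2 * π / dirLen B⌋₊ := by
    refine Nat.le_floor ?_
    rw [Nat.cast_mul, Nat.cast_two]
    have hkle : (k : ℝ) ≤ 2 * π / dirLen B' := Nat.floor_le (by positivity)
    have : 2 * π / dirLen B' * 2 ≤ 2 * π / dirLen B := by
      rw [div_mul_eq_mul_div, div_le_div_iff₀ hB' hB]
      nlinarith [two_pi_pos]
    nlinarith
  calc Nat.log 2 k < Nat.log 2 k + 1 := Nat.lt_succ_self _
    _ = Nat.log 2 (k * 2) := (Nat.log_mul_base one_lt_two (by omega)).symm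
    _ ≤ Nat.log 2 ⌊2 * π / dirLen B⌋₊ := Nat.log_mono_right h2k

/-- The full circle has potential `0`. [cite: MochizukiFrdII2008, Prop 3.4 (viii) p.32] -/
theorem lenRank_univ : lenRank (univ : Set ↥(normOneSubgroup ℂ)) = 0 := by
  rw [lenRank, dirLen_univ, div_self two_pi_pos.ne', Nat.floor_one, Nat.log_one_right]

end Rank

/-! ### The potential of an object of `C₀` -/

namespace C0

/-- **The FSMI-potential of an object of `C₀`**: `0` for real objects; for complex objects the doubling
potential of the angular part, plus one unless the object is (naively) isotropic. Along the arrows of the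
angular Frobenioid / angloids it never increases and it drops along every FSMI-morphism between complex
objects (`ArchimedeanFSMIPotential.lean`), which yields the bound `N` of the proof of Prop. 3.4 (viii)
(p. 32 ll. 18–30). [cite: MochizukiFrdII2008, Prop 3.4 (viii) p.32] -/
def fsmiRank (X : C0) : ℕ :=
  open scoped Classical in
  if X.IsRealObj then 0 else lenRank X.region.dir + (if X.region.IsIsotropic then 0 else 1)

/-- The potential of a real object. [cite: MochizukiFrdII2008, Prop 3.4 (viii) p.32] -/
theorem fsmiRank_of_isRealObj {X : C0} (h : X.IsRealObj) : X.fsmiRank = 0 := by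
  unfold fsmiRank; rw [if_pos h]

/-- The potential of a complex, not (naively) isotropic object. [cite: MochizukiFrdII2008, Prop 3.4 (viii) p.32] -/
theorem fsmiRank_of_not_isIsotropic {X : C0} (h : X.IsComplexObj) (hn : ¬ X.region.IsIsotropic) :
    X.fsmiRank = lenRank X.region.dir + 1 := by
  classical
  unfold fsmiRank
  rw [if_neg, if_neg hn]
  intro hr; exact absurd (hr.symm.trans h) (by decide)

/-- The potential of a complex isotropic object is `0`. [cite: MochizukiFrdII2008, Prop 3.4 (viii) p.32] -/
theorem fsmiRank_of_isIsotropic {X : C0} (h : X.IsComplexObj) (hi : X.region.IsIsotropic) :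
    X.fsmiRank = 0 := by
  classical
  unfold fsmiRank
  rw [if_neg, if_pos hi, show X.region.dir = univ from hi, lenRank_univ]
  intro hr; exact absurd (hr.symm.trans h) (by decide)

/-- Lower bound: the doubling potential of the angular part. [cite: MochizukiFrdII2008, Prop 3.4 (viii) p.32] -/
theorem lenRank_le_fsmiRank {X : C0} (h : X.IsComplexObj) : lenRank X.region.dir ≤ X.fsmiRank := by
  by_cases hi : X.region.IsIsotropic
  · rw [fsmiRank_of_isIsotropic h hi, show X.region.dir = univ from hi, lenRank_univ]
  · rw [fsmiRank_of_not_isIsotropic h hi]; exact Nat.le_succ _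

/-- Upper bound. [cite: MochizukiFrdII2008, Prop 3.4 (viii) p.32] -/
theorem fsmiRank_le {X : C0} (h : X.IsComplexObj) : X.fsmiRank ≤ lenRank X.region.dir + 1 := by
  by_cases hi : X.region.IsIsotropic
  · rw [fsmiRank_of_isIsotropic h hi]; exact Nat.zero_le _
  · rw [fsmiRank_of_not_isIsotropic h hi]

end C0

/-! ### Monotonicity along the arrows of `C₀` -/

namespace C0

variable {X Y : C0}

/-- Condition (c) of an arrow `φ : X → Y` of `C₀` on angular parts: `(c/|c|) · B_X^{d}` lies in the
angular part of the base-changed region `A_Y|_{Base φ}`, which is a Galois twist of `B_Y`.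
[cite: MochizukiFrdII2008, Ex 3.3 (i) p.27] -/
theorem smul_dir_pow_subset (φ : X ⟶ Y) :
    ∃ A : AngularRegion ℂ, A.carrier = pullRegion Y (Base φ) ∧ A.tip = Y.region.tip ∧
      A.dir = (fun z : ↥(normOneSubgroup ℂ) => unitPart ℂ ((Base φ).act (z : ℂˣ))) '' Y.region.dir ∧
      unitPart ℂ (scalar φ) • X.region.dir ^ (degFr φ : ℕ) ⊆ A.dir ∧
      absHom ℂ (scalar φ) * X.region.tip ^ (degFr φ : ℕ) ≤ A.tip := by
  obtain ⟨A, hAc, hAt, hAd, -⟩ := exists_pulledRegion Y (Base φ)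
  have hm : scalar φ • X.region.carrier ^ (degFr φ : ℕ) ⊆ A.carrier := by
    rw [hAc]; exact φ.mapsTo
  rw [← (degFr φ).natPred_add_one] at hm ⊢
  obtain ⟨h₁, h₂⟩ := (X.region.smul_carrier_pow_subset_iff A (scalar φ) (degFr φ).natPred).1 hm
  exact ⟨A, hAc, hAt, hAd, h₁, h₂⟩

/-- The angular part of the pulled-back region is connected and open, of the same angular length as
`B_Y`. [cite: MochizukiFrdII2008, Def 3.1 (iv) p.24] -/
theorem dirLen_twist_dir (Y : C0) {L : D0} (f : L ⟶ Y.base) :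
    dirLen ((fun z : ↥(normOneSubgroup ℂ) => unitPart ℂ (f.act (z : ℂˣ))) '' Y.region.dir) =
      dirLen Y.region.dir :=
  dirLen_twist Y.region.isConnected_dir Y.region.isOpen_dir f

/-- **"Angular regions never shrink" along ANY arrow of `C₀`**: `dirLen B_X ≤ dirLen B_Y` for every
`φ : X → Y`. [cite: MochizukiFrdII2008, Prop 3.4 (viii) p.32] -/
theorem dirLen_le_of_hom (φ : X ⟶ Y) : dirLen X.region.dir ≤ dirLen Y.region.dir := by
  obtain ⟨A, -, -, hAd, hsub, -⟩ := smul_dir_pow_subset φ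
  set n := (degFr φ).natPred with hn
  have hd : (degFr φ : ℕ) = n + 1 := ((degFr φ).natPred_add_one).symm
  rw [hd] at hsub
  obtain ⟨z₀, hz₀⟩ := X.region.dir_nonempty
  -- a translate of `B_X` inside `B_X^{n+1}`
  have htr : (unitPart ℂ (scalar φ) * z₀ ^ n) • X.region.dir ⊆ A.dir := by
    refine Subset.trans ?_ hsub
    rintro _ ⟨z, hz, rfl⟩
    change (unitPart ℂ (scalar φ) * z₀ ^ n) • z ∈ _
    rw [smul_eq_mul, mul_assoc]
    refine Set.smul_mem_smul_set (a := unitPart ℂ (scalar φ)) ?_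
    rw [pow_succ]
    exact Set.mul_mem_mul (Set.pow_mem_pow hz₀) hz
  have hAconn : IsConnected A.dir := A.isConnected_dir
  calc dirLen X.region.dir
      = dirLen ((unitPart ℂ (scalar φ) * z₀ ^ n) • X.region.dir) :=
        (dirLen_smul X.region.isConnected_dir X.region.isOpen_dir _).symm
    _ ≤ dirLen A.dir := dirLen_mono (isConnected_smul _ X.region.isConnected_dir)
        (isOpen_smul _ X.region.isOpen_dir) hAconn A.isOpen_dir htr
    _ = dirLen Y.region.dir := by rw [hAd, dirLen_twist_dir]

/-- The doubling potential of the angular part never increases along an arrow of `C₀`.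
[cite: MochizukiFrdII2008, Prop 3.4 (viii) p.32] -/
theorem lenRank_le_of_hom (φ : X ⟶ Y) : lenRank Y.region.dir ≤ lenRank X.region.dir :=
  lenRank_anti (dirLen_le_of_hom φ)

/-- **The FSMI-potential never increases along an arrow of `C₀`.** [cite: MochizukiFrdII2008, Prop 3.4 (viii) p.32] -/
theorem fsmiRank_le_of_hom (φ : X ⟶ Y) : Y.fsmiRank ≤ X.fsmiRank := by
  rcases D0.isReal_or_isComplex Y.base with hY | hY
  · rw [fsmiRank_of_isRealObj hY]; exact Nat.zero_le _
  rcases D0.isReal_or_isComplex X.base with hX | hX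
  · exact absurd ((C0.isRealObj_of_hom φ hX).symm.trans hY) (by decide)
  by_cases hXi : X.region.IsIsotropic
  · have hYi : Y.region.IsIsotropic := isNaivelyIsotropic_of_hom φ hXi
    rw [fsmiRank_of_isIsotropic hX hXi, fsmiRank_of_isIsotropic hY hYi]
  · rw [fsmiRank_of_not_isIsotropic hX hXi]
    exact (fsmiRank_le hY).trans (Nat.succ_le_succ (lenRank_le_of_hom φ))

/-- Injectivity of `a ↦ c · a^d` on the angular region `A_X` gives injectivity of `z ↦ z^d` on the
angular part `B_X` (read on the boundary `|a| = tip`). [cite: MochizukiFrdII2008, Rmk 3.3.1 p.29] -/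
theorem injOn_pow_dir_of_injOn_regionMap (φ : X ⟶ Y) (hinj : InjOn (regionMap φ) X.region.carrier) :
    InjOn (fun z : ↥(normOneSubgroup ℂ) => z ^ (degFr φ : ℕ)) X.region.dir := by
  intro z₁ hz₁ z₂ hz₂ h
  have hm : ∀ {z : ↥(normOneSubgroup ℂ)}, z ∈ X.region.dir →
      (z : ℂˣ) * ofPosReal ℂ X.region.tip ∈ X.region.carrier := fun hz =>
    (X.region.coe_mul_ofPosReal_mem_carrier_iff _ _).2 ⟨hz, le_rfl⟩
  have heq : regionMap φ ((z₁ : ℂˣ) * ofPosReal ℂ X.region.tip) =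
      regionMap φ ((z₂ : ℂˣ) * ofPosReal ℂ X.region.tip) := by
    unfold regionMap
    have h' : ((z₁ : ℂˣ)) ^ (degFr φ : ℕ) = (z₂ : ℂˣ) ^ (degFr φ : ℕ) := by
      have := congrArg (fun z : ↥(normOneSubgroup ℂ) => (z : ℂˣ)) h
      simpa only [Subgroup.coe_pow] using this
    rw [mul_pow, mul_pow, h']
  have := hinj (hm hz₁) (hm hz₂) heq
  exact Subtype.ext (mul_right_cancel this)

/-- **The potential drops along a non-linear arrow between complex objects that is injective on the
angular region** (a non-linear monomorphism, Remark 3.3.1): `z ↦ z^d` injective on `B_X` forces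
`d · dirLen B_X ≤ 2π` (Lemma 3.2 (v)), and `B_Y` contains a translate of a twist of `B_X^{·d}`, of length
`≥ d · dirLen B_X ≥ 2 · dirLen B_X` (Lemma 3.2 (iv)). [cite: MochizukiFrdII2008, Prop 3.4 (viii) p.32] -/
theorem fsmiRank_lt_of_injOn (φ : X ⟶ Y) (hX : X.IsComplexObj) (hY : Y.IsComplexObj)
    (hd : 2 ≤ (degFr φ : ℕ)) (hinj : InjOn (regionMap φ) X.region.carrier) :
    Y.fsmiRank < X.fsmiRank := by
  have hconn := X.region.isConnected_dir
  have hopen := X.region.isOpen_dir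
  have hinj' := injOn_pow_dir_of_injOn_regionMap φ hinj
  have h2π : (degFr φ : ℕ) * dirLen X.region.dir ≤ 2 * Real.pi :=
    mul_dirLen_le_of_injOn hconn hopen hd hinj'
  -- `X` is not isotropic (else `z ↦ z^d` is not injective on all of `S¹`)
  have hXi : ¬ X.region.IsIsotropic := by
    intro hi
    rw [show X.region.dir = univ from hi, dirLen_univ] at h2π
    have : (2 : ℝ) ≤ (degFr φ : ℕ) := by exact_mod_cast hd
    nlinarith [Real.two_pi_pos]
  -- `dirLen B_Y ≥ d · dirLen B_X ≥ 2 · dirLen B_X`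
  obtain ⟨A, -, -, hAd, hsub, -⟩ := smul_dir_pow_subset φ
  have hpow : (degFr φ : ℕ) * dirLen X.region.dir ≤ dirLen (X.region.dir ^ (degFr φ : ℕ)) :=
    mul_dirLen_le_dirLen_pow hconn hopen (degFr φ).pos h2π
  have hpc : IsConnected (X.region.dir ^ (degFr φ : ℕ)) := by
    rw [← (degFr φ).natPred_add_one]; exact isConnected_pow hconn _
  have hpo : IsOpen (X.region.dir ^ (degFr φ : ℕ)) := by
    rw [← (degFr φ).natPred_add_one]; exact isOpen_pow hopen _
  have hY' : dirLen (X.region.dir ^ (degFr φ : ℕ)) ≤ dirLen Y.region.dir :=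
    calc dirLen (X.region.dir ^ (degFr φ : ℕ))
        = dirLen (unitPart ℂ (scalar φ) • X.region.dir ^ (degFr φ : ℕ)) := (dirLen_smul hpc hpo _).symm
      _ ≤ dirLen A.dir := dirLen_mono (isConnected_smul _ hpc) (isOpen_smul _ hpo) A.isConnected_dir
          A.isOpen_dir hsub
      _ = dirLen Y.region.dir := by rw [hAd, dirLen_twist_dir]
  have h2 : 2 * dirLen X.region.dir ≤ dirLen Y.region.dir := by
    have : (2 : ℝ) ≤ (degFr φ : ℕ) := by exact_mod_cast hd
    nlinarith [dirLen_pos X.region.dir]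
  have hlt := lenRank_lt_of_two_mul_le h2
  rw [fsmiRank_of_not_isIsotropic hX hXi]
  exact Nat.lt_succ_of_le ((fsmiRank_le hY).trans hlt)

/-- **The potential drops from a non-isotropic complex object to an isotropic or real one** (the slit
case of the printed argument: "the codomain of `φ_j` is isotropic, so no `φ_{j′}`, `j′ > j`, can be a
slit morphism"). [cite: MochizukiFrdII2008, Prop 3.4 (viii) p.32] -/
theorem fsmiRank_lt_of_isIsotropic (hX : X.IsComplexObj) (hXi : ¬ X.region.IsIsotropic)
    (hY : Y.IsRealObj ∨ Y.region.IsIsotropic) : Y.fsmiRank < X.fsmiRank := by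
  rw [fsmiRank_of_not_isIsotropic hX hXi]
  have : Y.fsmiRank = 0 := by
    rcases D0.isReal_or_isComplex Y.base with hYr | hYc
    · exact fsmiRank_of_isRealObj hYr
    · rcases hY with hYr | hYi
      · exact absurd (hYr.symm.trans hYc) (by decide)
      · exact fsmiRank_of_isIsotropic hYc hYi
  rw [this]
  exact Nat.succ_pos _

end C0

end ArchFrd

end

end Literature.AlgebraicGeometry.Frobenioids
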